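import Summits.AtomisticToContinuum.FouriersLaw.Theorems.HiddenChargeMazurDressedChargeStubBlockOverlapMoments
import Summits.AtomisticToContinuum.FouriersLaw.Theorems.HiddenChargeMazurDressedChargeStubBlockOverlapOrthogonality

/-!
# Sub-extensive current overlap of polynomial block observables (stub S2b of crux `DressedCharge`)

Stub `stub_blockOverlap` (S2b) of line `birth` of the crux
`Summit.AtomisticToContinuum.FouriersLaw.Theses.HiddenChargeMazur.DressedCharge`
(item stmt-AtomisticToContinuum-13509, route `HiddenChargeMazur`); a `--supports` file, it closes
no item by itself.

For `P = pinnedChain ω₂ lam β γ` (all parameters `> 0`), `T > 0`, and a POLYNOMIAL block observable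
`K` of `L` sites read off the sites `e 0, …, e (L-1)` of the chain (zero-padded where `e i ≥ N`; the
head block is `e i = i`, the tail block `e i = N - L + i`), the static overlap with the total current
`J_N = ∑_k j_k` under the Gibbs measure `volume.tilted (-H_N/T)` obeys
`|E[J_N · K(block)]| ≤ 2L √(N K₀ · E[K(block)²])` (far bonds are orthogonal, touching bonds by
Cauchy–Schwarz, file `…StubBlockOverlapOrthogonality`) and `E[K(block)²] = O(√N)` (polynomial
domination + moments of every order, file `…StubBlockOverlapMoments`), hence is `O(N^{3/4})`, in
particular eventually `≤ c N` for every `c > 0`; the products are integrable.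
-/

noncomputable section

open MeasureTheory
open scoped BigOperators
open Literature.MathematicalPhysics.KineticTheory.HeatConduction
open Summit.AtomisticToContinuum.FouriersLaw.Theorems.SubdiffusiveBondHeat
open Summit.AtomisticToContinuum.FouriersLaw.Theorems.LightConeBondHeat
open Summit.AtomisticToContinuum.FouriersLaw.Theorems.NoOddCharge

namespace Summit.AtomisticToContinuum.FouriersLaw.Theorems.DressedCharge

variable {ω₂ lam β : ℝ}

/-! ### The block observable `z ↦ K(z_{e 0}, …, z_{e (L-1)})` of a polynomial `K` -/

/-- **Energy domination of a polynomial block observable**: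
`|K(block z)| ≤ (∑|coeff|) (1 + |σ|(5 + 4/lam))^{deg} (1+H)^{2 deg}`. [folklore] -/
theorem pinnedChain_abs_blockObs_le (hω : 0 ≤ ω₂) (hl : 0 < lam) (hβ : 0 ≤ β) (γ : ℝ) (N : ℕ) {L : ℕ}
    {K : (Fin L → ℝ × ℝ) → ℝ} {p : MvPolynomial (Fin L ⊕ Fin L) ℝ}
    (hp : ∀ y : Fin L → ℝ × ℝ, K y = MvPolynomial.eval (Sum.elim (fun i => (y i).1) (fun i => (y i).2)) p)
    (e : Fin L → ℕ) (z : PhaseSpace N) :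
    |K (fun i : Fin L => if h : e i < N then (z.1 ⟨e i, h⟩, z.2 ⟨e i, h⟩) else (0, 0))| ≤
      (∑ d ∈ p.support, |p.coeff d|) *
        (1 + (Fintype.card (Fin L ⊕ Fin L) : ℝ) * (5 + 4 / lam)) ^ p.totalDegree *
        ((1 + (pinnedChain ω₂ lam β γ).hamiltonian N z) ^ (2 * p.totalDegree)) := by
  rw [hp]
  have hH0 := pinnedChain_hamiltonian_nonneg hω hl.le hβ γ N z
  set Hm := (pinnedChain ω₂ lam β γ).hamiltonian N z with hHm
  refine (abs_eval_le_sum_abs_coeff_mul_pow p _).trans ?_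
  rw [mul_assoc]
  refine mul_le_mul_of_nonneg_left ?_ (Finset.sum_nonneg fun d _ => abs_nonneg _)
  rw [pow_mul, ← mul_pow]
  refine pow_le_pow_left₀ (add_nonneg zero_le_one (Finset.sum_nonneg fun s _ => abs_nonneg _)) ?_ _
  have hsum := Finset.sum_le_sum (s := Finset.univ) fun s _ => pinnedChain_abs_blockVar_le hω hl hβ γ N e z s
  rw [Finset.sum_const, Finset.card_univ, nsmul_eq_mul] at hsum
  have h1 : (1:ℝ) ≤ (1 + Hm) ^ 2 := one_le_pow₀ (by linarith)
  have hc : (0:ℝ) ≤ (Fintype.card (Fin L ⊕ Fin L) : ℝ) * (5 + 4 / lam) := by positivity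
  calc 1 + ∑ s, |Sum.elim (fun i : Fin L => (if h : e i < N then (z.1 ⟨e i, h⟩, z.2 ⟨e i, h⟩) else ((0:ℝ), (0:ℝ))).1)
          (fun i : Fin L => (if h : e i < N then (z.1 ⟨e i, h⟩, z.2 ⟨e i, h⟩) else ((0:ℝ), (0:ℝ))).2) s|
      ≤ 1 + (Fintype.card (Fin L ⊕ Fin L) : ℝ) * ((5 + 4 / lam) * (1 + Hm) ^ 2) := by linarith
    _ ≤ (1 + (Fintype.card (Fin L ⊕ Fin L) : ℝ) * (5 + 4 / lam)) * (1 + Hm) ^ 2 := by nlinarith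

/-- **Continuity of a polynomial block observable.** [folklore] -/
theorem continuous_blockObs (N : ℕ) {L : ℕ} {K : (Fin L → ℝ × ℝ) → ℝ} {p : MvPolynomial (Fin L ⊕ Fin L) ℝ}
    (hp : ∀ y : Fin L → ℝ × ℝ, K y = MvPolynomial.eval (Sum.elim (fun i => (y i).1) (fun i => (y i).2)) p)
    (e : Fin L → ℕ) :
    Continuous fun z : PhaseSpace N =>
      K (fun i : Fin L => if h : e i < N then (z.1 ⟨e i, h⟩, z.2 ⟨e i, h⟩) else (0, 0)) := by
  simp only [hp]
  refine (MvPolynomial.continuous_eval p).comp (continuous_pi fun s => ?_)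
  rcases s with i | i
  · simp only [Sum.elim_inl]
    by_cases h : e i < N
    · simp only [dif_pos h]
      fun_prop
    · simp only [dif_neg h]
      exact continuous_const
  · simp only [Sum.elim_inr]
    by_cases h : e i < N
    · simp only [dif_pos h]
      fun_prop
    · simp only [dif_neg h]
      exact continuous_const

/-- **Momentum locality of a block observable**: modifying a momentum `p_k` at a site `k` outside
`{e 0, …, e (L-1)}` does not change `K(block z)`. [folklore] -/
theorem blockObs_update_of_forall_ne (N : ℕ) {L : ℕ} (K : (Fin L → ℝ × ℝ) → ℝ) (e : Fin L → ℕ)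
    (k : Fin N) (hk : ∀ i, e i ≠ k.val) (z : PhaseSpace N) (t : ℝ) :
    K (fun i : Fin L => if h : e i < N then
        (((z.1, Function.update z.2 k t) : PhaseSpace N).1 ⟨e i, h⟩,
          ((z.1, Function.update z.2 k t) : PhaseSpace N).2 ⟨e i, h⟩) else (0, 0)) =
      K (fun i : Fin L => if h : e i < N then (z.1 ⟨e i, h⟩, z.2 ⟨e i, h⟩) else (0, 0)) := by
  congr 1
  funext i
  by_cases h : e i < N
  · simp only [dif_pos h]
    have hne : (⟨e i, h⟩ : Fin N) ≠ k := fun heq => hk i (congrArg Fin.val heq)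
    rw [Function.update_of_ne hne]
  · simp only [dif_neg h]

/-! ### The second Gibbs moment of a block observable is `O(√N)` -/

/-- **Per-site moments of the block variables.** If `E_μ[q_i^{2D}] ≤ Cq √N` and `E_μ[p_i^{2D}] ≤ Mp`
for all sites, then the `2D`-th powers of the block coordinates (padding zeros included) are
`μ`-integrable with expectations `≤ 1 + Cq √N`, resp. `≤ 1 + Mp`. [folklore] -/
theorem pinnedChain_gibbs_blockVar_pow_le (hω : 0 < ω₂) (hl : 0 < lam) (hβ : 0 ≤ β) (γ : ℝ) (N : ℕ)
    {T : ℝ} (hT : 0 < T) {L : ℕ} (e : Fin L → ℕ) (D : ℕ) {Cq Mp : ℝ} (hCq0 : 0 ≤ Cq) (hMp0 : 0 ≤ Mp)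
    (hCq : ∀ i : Fin N, ∫ x, x.1 i ^ (2 * D) ∂((pinnedChain ω₂ lam β γ).gibbsMeasure N T) ≤ Cq * Real.sqrt N)
    (hMp : ∀ i : Fin N, ∫ x, x.2 i ^ (2 * D) ∂((pinnedChain ω₂ lam β γ).gibbsMeasure N T) ≤ Mp)
    (i : Fin L) :
    Integrable (fun z : PhaseSpace N =>
        (if h : e i < N then (z.1 ⟨e i, h⟩, z.2 ⟨e i, h⟩) else ((0:ℝ), (0:ℝ))).1 ^ (2 * D))
        ((pinnedChain ω₂ lam β γ).gibbsMeasure N T) ∧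
      Integrable (fun z : PhaseSpace N =>
        (if h : e i < N then (z.1 ⟨e i, h⟩, z.2 ⟨e i, h⟩) else ((0:ℝ), (0:ℝ))).2 ^ (2 * D))
        ((pinnedChain ω₂ lam β γ).gibbsMeasure N T) ∧
      ∫ z : PhaseSpace N, (if h : e i < N then (z.1 ⟨e i, h⟩, z.2 ⟨e i, h⟩) else ((0:ℝ), (0:ℝ))).1 ^ (2 * D)
        ∂((pinnedChain ω₂ lam β γ).gibbsMeasure N T) ≤ 1 + Cq * Real.sqrt N ∧
      ∫ z : PhaseSpace N, (if h : e i < N then (z.1 ⟨e i, h⟩, z.2 ⟨e i, h⟩) else ((0:ℝ), (0:ℝ))).2 ^ (2 * D)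
        ∂((pinnedChain ω₂ lam β γ).gibbsMeasure N T) ≤ 1 + Mp := by
  set P := pinnedChain ω₂ lam β γ with hP
  haveI := pinnedChain_isProbabilityMeasure_gibbsMeasure hω hl.le hβ γ N hT
  by_cases h : e i < N
  · simp only [dif_pos h]
    refine ⟨?_, ?_, ?_, ?_⟩
    · exact P.integrable_gibbsMeasure
        (pinnedChain_integrable_position_pow_mul_gibbsDensity' hω hl hβ γ N hT ⟨e i, h⟩ (2 * D))
    · exact P.integrable_gibbsMeasure
        (pinnedChain_integrable_momentum_pow_mul_gibbsDensity' hω hl.le hβ γ N hT ⟨e i, h⟩ (2 * D))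
    · have := hCq ⟨e i, h⟩
      linarith
    · have := hMp ⟨e i, h⟩
      linarith
  · simp only [dif_neg h]
    have h01 : (0:ℝ) ^ (2 * D) ≤ 1 := by
      rcases Nat.eq_zero_or_pos D with hD | hD
      · simp [hD]
      · rw [zero_pow (by omega)]
        exact zero_le_one
    have hsN : 0 ≤ Cq * Real.sqrt N := mul_nonneg hCq0 (Real.sqrt_nonneg _)
    refine ⟨integrable_const _, integrable_const _, ?_, ?_⟩
    · simp only [integral_const, smul_eq_mul, Measure.real, measure_univ, ENNReal.toReal_one, one_mul]
      linarith
    · simp only [integral_const, smul_eq_mul, Measure.real, measure_univ, ENNReal.toReal_one, one_mul]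
      linarith

/-- **Second Gibbs moment of a polynomial block observable**:
`E_μ[K(block)²] ≤ A_p (1 + L ((1 + Cq √N) + (1 + Mp)))` with `A_p = ((∑|coeff|)(|σ|+1)^{deg})²`, where
`Cq, Mp` bound the single-site moments of order `2 deg`. [folklore] -/
theorem pinnedChain_gibbs_blockObs_sq_le (hω : 0 < ω₂) (hl : 0 < lam) (hβ : 0 ≤ β) (γ : ℝ) (N : ℕ)
    {T : ℝ} (hT : 0 < T) {L : ℕ} {K : (Fin L → ℝ × ℝ) → ℝ} {p : MvPolynomial (Fin L ⊕ Fin L) ℝ}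
    (hp : ∀ y : Fin L → ℝ × ℝ, K y = MvPolynomial.eval (Sum.elim (fun i => (y i).1) (fun i => (y i).2)) p)
    (e : Fin L → ℕ) {Cq Mp : ℝ} (hCq0 : 0 ≤ Cq) (hMp0 : 0 ≤ Mp)
    (hCq : ∀ i : Fin N, ∫ x, x.1 i ^ (2 * p.totalDegree) ∂((pinnedChain ω₂ lam β γ).gibbsMeasure N T) ≤
      Cq * Real.sqrt N)
    (hMp : ∀ i : Fin N, ∫ x, x.2 i ^ (2 * p.totalDegree) ∂((pinnedChain ω₂ lam β γ).gibbsMeasure N T) ≤ Mp) :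
    ∫ z, (K (fun i : Fin L => if h : e i < N then (z.1 ⟨e i, h⟩, z.2 ⟨e i, h⟩) else (0, 0))) ^ 2
        ∂((pinnedChain ω₂ lam β γ).gibbsMeasure N T) ≤
      ((∑ d ∈ p.support, |p.coeff d|) * ((Fintype.card (Fin L ⊕ Fin L) : ℝ) + 1) ^ p.totalDegree) ^ 2 *
        (1 + L * ((1 + Cq * Real.sqrt N) + (1 + Mp))) := by
  set P := pinnedChain ω₂ lam β γ with hP
  set μ := P.gibbsMeasure N T with hμ
  set D := p.totalDegree with hD
  set A : ℝ := ((∑ d ∈ p.support, |p.coeff d|) * ((Fintype.card (Fin L ⊕ Fin L) : ℝ) + 1) ^ D) ^ 2 with hA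
  have hA0 : 0 ≤ A := sq_nonneg _
  haveI := pinnedChain_isProbabilityMeasure_gibbsMeasure hω hl.le hβ γ N hT
  have hsite := pinnedChain_gibbs_blockVar_pow_le hω hl hβ γ N hT e D hCq0 hMp0 hCq hMp
  -- pointwise: `K(block z)² ≤ A (1 + (∑_i U_i + ∑_i W_i))`
  have hpt : ∀ z : PhaseSpace N,
      (K (fun i : Fin L => if h : e i < N then (z.1 ⟨e i, h⟩, z.2 ⟨e i, h⟩) else (0, 0))) ^ 2 ≤
        A * (1 + ((∑ i : Fin L, (if h : e i < N then (z.1 ⟨e i, h⟩, z.2 ⟨e i, h⟩) else ((0:ℝ), (0:ℝ))).1 ^ (2 * D)) +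
          ∑ i : Fin L, (if h : e i < N then (z.1 ⟨e i, h⟩, z.2 ⟨e i, h⟩) else ((0:ℝ), (0:ℝ))).2 ^ (2 * D))) := by
    intro z
    rw [hp]
    have h := eval_sq_le_mul_one_add_sum_pow p
      (Sum.elim (fun i : Fin L => (if h : e i < N then (z.1 ⟨e i, h⟩, z.2 ⟨e i, h⟩) else ((0:ℝ), (0:ℝ))).1)
        (fun i : Fin L => (if h : e i < N then (z.1 ⟨e i, h⟩, z.2 ⟨e i, h⟩) else ((0:ℝ), (0:ℝ))).2))
    rw [Fintype.sum_sum_type] at h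
    simpa only [Sum.elim_inl, Sum.elim_inr] using h
  have hIK : Integrable (fun z : PhaseSpace N =>
      (K (fun i : Fin L => if h : e i < N then (z.1 ⟨e i, h⟩, z.2 ⟨e i, h⟩) else (0, 0))) ^ 2) μ :=
    pinnedChain_integrable_gibbs_sq hω hl.le hβ γ N hT (continuous_blockObs N hp e) (2 * D)
      (pinnedChain_abs_blockObs_le hω.le hl hβ γ N hp e)
  have hIU : Integrable (fun z : PhaseSpace N => ∑ i : Fin L,
      (if h : e i < N then (z.1 ⟨e i, h⟩, z.2 ⟨e i, h⟩) else ((0:ℝ), (0:ℝ))).1 ^ (2 * D)) μ :=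
    integrable_finsetSum _ fun i _ => (hsite i).1
  have hIW : Integrable (fun z : PhaseSpace N => ∑ i : Fin L,
      (if h : e i < N then (z.1 ⟨e i, h⟩, z.2 ⟨e i, h⟩) else ((0:ℝ), (0:ℝ))).2 ^ (2 * D)) μ :=
    integrable_finsetSum _ fun i _ => (hsite i).2.1
  have hmaj : Integrable (fun z : PhaseSpace N =>
      A * (1 + ((∑ i : Fin L, (if h : e i < N then (z.1 ⟨e i, h⟩, z.2 ⟨e i, h⟩) else ((0:ℝ), (0:ℝ))).1 ^ (2 * D)) +
        ∑ i : Fin L, (if h : e i < N then (z.1 ⟨e i, h⟩, z.2 ⟨e i, h⟩) else ((0:ℝ), (0:ℝ))).2 ^ (2 * D)))) μ :=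
    ((integrable_const 1).add (hIU.add hIW)).const_mul A
  have hsumU : ∫ z, (∑ i : Fin L,
      (if h : e i < N then (z.1 ⟨e i, h⟩, z.2 ⟨e i, h⟩) else ((0:ℝ), (0:ℝ))).1 ^ (2 * D)) ∂μ ≤
      L * (1 + Cq * Real.sqrt N) := by
    rw [integral_finsetSum _ fun i _ => (hsite i).1]
    calc ∑ i : Fin L, ∫ z, (if h : e i < N then (z.1 ⟨e i, h⟩, z.2 ⟨e i, h⟩) else ((0:ℝ), (0:ℝ))).1 ^ (2 * D) ∂μ
        ≤ ∑ _i : Fin L, (1 + Cq * Real.sqrt N) := Finset.sum_le_sum fun i _ => (hsite i).2.2.1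
      _ = L * (1 + Cq * Real.sqrt N) := by
          rw [Finset.sum_const, Finset.card_univ, Fintype.card_fin, nsmul_eq_mul]
  have hsumW : ∫ z, (∑ i : Fin L,
      (if h : e i < N then (z.1 ⟨e i, h⟩, z.2 ⟨e i, h⟩) else ((0:ℝ), (0:ℝ))).2 ^ (2 * D)) ∂μ ≤ L * (1 + Mp) := by
    rw [integral_finsetSum _ fun i _ => (hsite i).2.1]
    calc ∑ i : Fin L, ∫ z, (if h : e i < N then (z.1 ⟨e i, h⟩, z.2 ⟨e i, h⟩) else ((0:ℝ), (0:ℝ))).2 ^ (2 * D) ∂μ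
        ≤ ∑ _i : Fin L, (1 + Mp) := Finset.sum_le_sum fun i _ => (hsite i).2.2.2
      _ = L * (1 + Mp) := by
          rw [Finset.sum_const, Finset.card_univ, Fintype.card_fin, nsmul_eq_mul]
  calc ∫ z, (K (fun i : Fin L => if h : e i < N then (z.1 ⟨e i, h⟩, z.2 ⟨e i, h⟩) else (0, 0))) ^ 2 ∂μ
      ≤ ∫ z, A * (1 + ((∑ i : Fin L, (if h : e i < N then (z.1 ⟨e i, h⟩, z.2 ⟨e i, h⟩) else ((0:ℝ), (0:ℝ))).1 ^ (2 * D)) +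
          ∑ i : Fin L, (if h : e i < N then (z.1 ⟨e i, h⟩, z.2 ⟨e i, h⟩) else ((0:ℝ), (0:ℝ))).2 ^ (2 * D))) ∂μ :=
        integral_mono hIK hmaj hpt
    _ = A * (1 + ((∫ z, (∑ i : Fin L,
            (if h : e i < N then (z.1 ⟨e i, h⟩, z.2 ⟨e i, h⟩) else ((0:ℝ), (0:ℝ))).1 ^ (2 * D)) ∂μ) +
          ∫ z, (∑ i : Fin L,
            (if h : e i < N then (z.1 ⟨e i, h⟩, z.2 ⟨e i, h⟩) else ((0:ℝ), (0:ℝ))).2 ^ (2 * D)) ∂μ)) := by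
        rw [integral_const_mul]
        congr 1
        have hIUW : Integrable (fun z : PhaseSpace N =>
            (∑ i : Fin L, (if h : e i < N then (z.1 ⟨e i, h⟩, z.2 ⟨e i, h⟩) else ((0:ℝ), (0:ℝ))).1 ^ (2 * D)) +
              ∑ i : Fin L, (if h : e i < N then (z.1 ⟨e i, h⟩, z.2 ⟨e i, h⟩) else ((0:ℝ), (0:ℝ))).2 ^ (2 * D)) μ :=
          hIU.add hIW
        rw [integral_add (integrable_const _) hIUW, integral_add hIU hIW]
        simp
    _ ≤ A * (1 + (L * (1 + Cq * Real.sqrt N) + L * (1 + Mp))) := by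
        refine mul_le_mul_of_nonneg_left ?_ hA0
        linarith
    _ = A * (1 + L * ((1 + Cq * Real.sqrt N) + (1 + Mp))) := by ring

/-! ### The overlap bound -/

/-- **Overlap of the total current with a polynomial block observable** (any site map `e`, any `N`):
`J_N K(block)` is integrable and `|E_μ[J_N K(block)]| ≤ 2L √(N K₀ · A_p (1 + L((1 + Cq √N) + (1 + Mp))))`
with `K₀ = 2T² + 384β²T³/(lam ω₂)`. [folklore] -/
theorem pinnedChain_gibbs_abs_totalCurrent_mul_blockObs_le (hω : 0 < ω₂) (hl : 0 < lam) (hβ : 0 < β)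
    (γ : ℝ) (N : ℕ) {T : ℝ} (hT : 0 < T) {L : ℕ} {K : (Fin L → ℝ × ℝ) → ℝ}
    {p : MvPolynomial (Fin L ⊕ Fin L) ℝ}
    (hp : ∀ y : Fin L → ℝ × ℝ, K y = MvPolynomial.eval (Sum.elim (fun i => (y i).1) (fun i => (y i).2)) p)
    (e : Fin L → ℕ) {Cq Mp : ℝ} (hCq0 : 0 ≤ Cq) (hMp0 : 0 ≤ Mp)
    (hCq : ∀ i : Fin N, ∫ x, x.1 i ^ (2 * p.totalDegree) ∂((pinnedChain ω₂ lam β γ).gibbsMeasure N T) ≤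
      Cq * Real.sqrt N)
    (hMp : ∀ i : Fin N, ∫ x, x.2 i ^ (2 * p.totalDegree) ∂((pinnedChain ω₂ lam β γ).gibbsMeasure N T) ≤ Mp) :
    Integrable (fun z : PhaseSpace N => (∑ k : Fin N, (pinnedChain ω₂ lam β γ).bondCurrent N k z) *
        K (fun i : Fin L => if h : e i < N then (z.1 ⟨e i, h⟩, z.2 ⟨e i, h⟩) else (0, 0)))
        ((pinnedChain ω₂ lam β γ).gibbsMeasure N T) ∧
      |∫ z, (∑ k : Fin N, (pinnedChain ω₂ lam β γ).bondCurrent N k z) *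
          K (fun i : Fin L => if h : e i < N then (z.1 ⟨e i, h⟩, z.2 ⟨e i, h⟩) else (0, 0))
          ∂((pinnedChain ω₂ lam β γ).gibbsMeasure N T)| ≤
        2 * L * Real.sqrt (N * (2 * T ^ 2 + 384 * β ^ 2 * T ^ 3 / (lam * ω₂)) *
          (((∑ d ∈ p.support, |p.coeff d|) * ((Fintype.card (Fin L ⊕ Fin L) : ℝ) + 1) ^ p.totalDegree) ^ 2 *
            (1 + L * ((1 + Cq * Real.sqrt N) + (1 + Mp))))) := by
  have hGc := continuous_blockObs N hp e
  have hle := pinnedChain_abs_blockObs_le hω.le hl hβ.le γ N hp e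
  refine ⟨pinnedChain_integrable_gibbs_totalCurrent_mul hω hl.le hβ.le γ N hT hGc _ hle, ?_⟩
  exact pinnedChain_gibbs_abs_totalCurrent_mul_le hω hl hβ γ N hT hGc _ hle
    (pinnedChain_gibbs_blockObs_sq_le hω hl hβ.le γ N hT hp e hCq0 hMp0 hCq hMp) e
    (fun k hk z t => blockObs_update_of_forall_ne N K e k hk z t)

/-- **`O(N^{3/4})` overlap, uniformly in the site map.** There is `E ≥ 0` (depending on
`ω₂, lam, β, T, L` and the polynomial only) such that for every `N ≥ 1` and every site map `e`,
`J_N K(block)` is integrable and `|E_μ[J_N K(block)]| ≤ E √(N √N)`. [folklore] -/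
theorem pinnedChain_gibbs_abs_totalCurrent_mul_blockObs_le_sqrt (hω : 0 < ω₂) (hl : 0 < lam)
    (hβ : 0 < β) (γ : ℝ) {T : ℝ} (hT : 0 < T) {L : ℕ} {K : (Fin L → ℝ × ℝ) → ℝ}
    {p : MvPolynomial (Fin L ⊕ Fin L) ℝ}
    (hp : ∀ y : Fin L → ℝ × ℝ, K y = MvPolynomial.eval (Sum.elim (fun i => (y i).1) (fun i => (y i).2)) p) :
    ∃ E : ℝ, 0 ≤ E ∧ ∀ N : ℕ, 1 ≤ N → ∀ e : Fin L → ℕ,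
      Integrable (fun z : PhaseSpace N => (∑ k : Fin N, (pinnedChain ω₂ lam β γ).bondCurrent N k z) *
          K (fun i : Fin L => if h : e i < N then (z.1 ⟨e i, h⟩, z.2 ⟨e i, h⟩) else (0, 0)))
          ((pinnedChain ω₂ lam β γ).gibbsMeasure N T) ∧
        |∫ z, (∑ k : Fin N, (pinnedChain ω₂ lam β γ).bondCurrent N k z) *
            K (fun i : Fin L => if h : e i < N then (z.1 ⟨e i, h⟩, z.2 ⟨e i, h⟩) else (0, 0))
            ∂((pinnedChain ω₂ lam β γ).gibbsMeasure N T)| ≤ E * Real.sqrt (N * Real.sqrt N) := by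
  obtain ⟨Cq, hCq0, hCq⟩ := pinnedChain_gibbs_position_pow_le_sqrt hω hl hβ.le γ hT p.totalDegree
  obtain ⟨Mp, hMp0, hMp⟩ := pinnedChain_gibbs_momentum_pow_le hω hl.le hβ.le γ hT p.totalDegree
  have hK0 : 0 ≤ 2 * T ^ 2 + 384 * β ^ 2 * T ^ 3 / (lam * ω₂) := by positivity
  have hA0 : 0 ≤ ((∑ d ∈ p.support, |p.coeff d|) *
      ((Fintype.card (Fin L ⊕ Fin L) : ℝ) + 1) ^ p.totalDegree) ^ 2 := sq_nonneg _
  have hL0 : (0:ℝ) ≤ L := Nat.cast_nonneg _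
  have hA2 : 0 ≤ ((∑ d ∈ p.support, |p.coeff d|) *
      ((Fintype.card (Fin L ⊕ Fin L) : ℝ) + 1) ^ p.totalDegree) ^ 2 * (1 + L * ((1 + Cq) + (1 + Mp))) := by
    positivity
  refine ⟨2 * L * Real.sqrt ((2 * T ^ 2 + 384 * β ^ 2 * T ^ 3 / (lam * ω₂)) *
      (((∑ d ∈ p.support, |p.coeff d|) * ((Fintype.card (Fin L ⊕ Fin L) : ℝ) + 1) ^ p.totalDegree) ^ 2 *
        (1 + L * ((1 + Cq) + (1 + Mp))))), by positivity, fun N hN e => ?_⟩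
  obtain ⟨hint, hb⟩ := pinnedChain_gibbs_abs_totalCurrent_mul_blockObs_le hω hl hβ γ N hT hp e hCq0 hMp0
    (hCq N) (hMp N)
  refine ⟨hint, hb.trans ?_⟩
  have hN1 : (1:ℝ) ≤ N := by exact_mod_cast hN
  have hN0 : (0:ℝ) ≤ N := Nat.cast_nonneg _
  have hsN1 : 1 ≤ Real.sqrt N := by
    rw [show (1:ℝ) = Real.sqrt 1 from Real.sqrt_one.symm]
    exact Real.sqrt_le_sqrt hN1
  have hsN0 : 0 ≤ Real.sqrt N := Real.sqrt_nonneg _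
  -- `B_N ≤ A₂ √N`
  have hB : 1 + L * ((1 + Cq * Real.sqrt N) + (1 + Mp)) ≤ (1 + L * ((1 + Cq) + (1 + Mp))) * Real.sqrt N := by
    nlinarith [mul_nonneg hL0 (sub_nonneg.mpr hsN1), mul_nonneg (mul_nonneg hL0 hMp0) (sub_nonneg.mpr hsN1),
      mul_nonneg (mul_nonneg hL0 hCq0) hsN0]
  set A : ℝ := ((∑ d ∈ p.support, |p.coeff d|) *
      ((Fintype.card (Fin L ⊕ Fin L) : ℝ) + 1) ^ p.totalDegree) ^ 2 with hA
  set K₀ : ℝ := 2 * T ^ 2 + 384 * β ^ 2 * T ^ 3 / (lam * ω₂) with hK₀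
  calc 2 * L * Real.sqrt (N * K₀ * (A * (1 + L * ((1 + Cq * Real.sqrt N) + (1 + Mp)))))
      ≤ 2 * L * Real.sqrt (N * K₀ * (A * ((1 + L * ((1 + Cq) + (1 + Mp))) * Real.sqrt N))) := by
        refine mul_le_mul_of_nonneg_left (Real.sqrt_le_sqrt ?_) (by positivity)
        exact mul_le_mul_of_nonneg_left (mul_le_mul_of_nonneg_left hB hA0) (by positivity)
    _ = 2 * L * Real.sqrt (K₀ * (A * (1 + L * ((1 + Cq) + (1 + Mp))))) * Real.sqrt (N * Real.sqrt N) := by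
        rw [show (N : ℝ) * K₀ * (A * ((1 + L * ((1 + Cq) + (1 + Mp))) * Real.sqrt N)) =
          (K₀ * (A * (1 + L * ((1 + Cq) + (1 + Mp))))) * (N * Real.sqrt N) by ring,
          Real.sqrt_mul (mul_nonneg hK0 hA2)]
        ring

/-- **Stub S2b `stub_blockOverlap` (sub-extensive block overlap).** For `P = pinnedChain ω₂ lam β γ`
(all `> 0`), `T > 0` and every POLYNOMIAL block observable `K` of `L` sites: the static overlap of
the total current `J_N = Σ_i j_i` with `K(head block)` and with `K(tail block)` under
`dGibbs_(N,T) = volume.tilted(−H_N/T)` is, for every `c > 0`, eventually `≤ c·N`, and the products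
are integrable.  Proof: `volume.tilted(−H_N/T)` is `P.gibbsMeasure N T` (`rfl`); both blocks are
instances (`e i = i`, `e i = N − L + i`) of `pinnedChain_gibbs_abs_totalCurrent_mul_blockObs_le_sqrt`
(`O(N^{3/4})`), and `E √(N√N) ≤ c N` once `N ≥ ⌈(E²/c²)²⌉₊ + 1`. -/
theorem stub_blockOverlap :
    ∀ ω₂ lam β γ T : ℝ, 0 < ω₂ → 0 < lam → 0 < β → 0 < γ → 0 < T →
    ∀ P : OscillatorChain, P = pinnedChain ω₂ lam β γ →
    ∀ (L : ℕ) (K : (Fin L → ℝ × ℝ) → ℝ),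
      (∃ p : MvPolynomial (Fin L ⊕ Fin L) ℝ, ∀ y : Fin L → ℝ × ℝ, K y = MvPolynomial.eval (Sum.elim (fun i => (y i).1) (fun i => (y i).2)) p) →
    ∀ c : ℝ, 0 < c → ∃ N₁ : ℕ, ∀ N : ℕ, N₁ ≤ N →
      MeasureTheory.Integrable (fun z : PhaseSpace N => (∑ i : Fin N, P.bondCurrent N i z) *
          K (fun i : Fin L => if h : i.val < N then (z.1 ⟨i.val, h⟩, z.2 ⟨i.val, h⟩) else (0, 0)))
        (MeasureTheory.volume.tilted fun x => -P.hamiltonian N x / T) ∧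
      MeasureTheory.Integrable (fun z : PhaseSpace N => (∑ i : Fin N, P.bondCurrent N i z) *
          K (fun i : Fin L => if h : N - L + i.val < N then (z.1 ⟨N - L + i.val, h⟩, z.2 ⟨N - L + i.val, h⟩) else (0, 0)))
        (MeasureTheory.volume.tilted fun x => -P.hamiltonian N x / T) ∧
      |∫ z, (∑ i : Fin N, P.bondCurrent N i z) *
          K (fun i : Fin L => if h : i.val < N then (z.1 ⟨i.val, h⟩, z.2 ⟨i.val, h⟩) else (0, 0))
          ∂(MeasureTheory.volume.tilted fun x => -P.hamiltonian N x / T)| ≤ c * N ∧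
      |∫ z, (∑ i : Fin N, P.bondCurrent N i z) *
          K (fun i : Fin L => if h : N - L + i.val < N then (z.1 ⟨N - L + i.val, h⟩, z.2 ⟨N - L + i.val, h⟩) else (0, 0))
          ∂(MeasureTheory.volume.tilted fun x => -P.hamiltonian N x / T)| ≤ c * N := by
  intro ω₂ lam β γ T hω hl hβ _hγ hT P hP L K hK c hc
  obtain ⟨p, hp⟩ := hK
  subst hP
  obtain ⟨E, -, hE⟩ := pinnedChain_gibbs_abs_totalCurrent_mul_blockObs_le_sqrt hω hl hβ γ hT hp
  refine ⟨⌈(E ^ 2 / c ^ 2) ^ 2⌉₊ + 1, fun N hN => ?_⟩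
  have hN1 : 1 ≤ N := le_trans (Nat.le_add_left 1 _) hN
  have hfin := mul_sqrt_mul_sqrt_le_of_le hc hN
  obtain ⟨hi1, hb1⟩ := hE N hN1 (fun i : Fin L => i.val)
  obtain ⟨hi2, hb2⟩ := hE N hN1 (fun i : Fin L => N - L + i.val)
  rw [← OscillatorChain.gibbsMeasure_eq]
  exact ⟨hi1, hi2, hb1.trans hfin, hb2.trans hfin⟩

end Summit.AtomisticToContinuum.FouriersLaw.Theorems.DressedCharge

end
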